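import Summits.CriticalPhenomena.SAWScalingLimit.Theorems.MassRatio.Negative.Component
import Summits.CriticalPhenomena.SAWScalingLimit.Theorems.MassRatio.Negative.Frames

/-!
# Crux `MassRatio` (stmt-CriticalPhenomena-8550) — load-bearing hypotheses, part 23 (cycle 4): `Preconnected` is decoration modulo two geometric blocks

Negative-series file (refuter, cdisprove). `compA` (the root component as a function of the root mid-edge),
`FrameNoConn` (the frame without `Preconnected`), `MassRatioAtWithoutPreconnected c σ τ` (the crux at cut `c` with the
`Preconnected` conjunct deleted — a strengthening: `massRatioAt_of_withoutPreconnected`), and the transport tools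
`observable_eq_zero_of_forall_not_mem`, `finsum_comp_eq` (the `K`-restricted `L¹` mass of `F_σ` is the same on `Λ` and on
the root component). The two geometric blocks (rows clause / exhaustion pass to the root component) and the resulting
EQUIVALENCE `MassRatioAtWithoutPreconnected c σ τ ↔ MassRatioAt c σ τ` are parts 24–27 (`HalfBall`, `RowsComp`,
`ExhaustsComp`).
-/

namespace Summit.CriticalPhenomena.SAWScalingLimit.Theorems.MassRatio.Negative

open Literature.Probability.LatticeModels Literature.Probability.RandomPlanarGeometry.SAW
open Literature.Probability.RandomPlanarGeometry

/-! ## §M.4 `Preconnected` is decoration — the assembly, modulo two geometric blocks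

The component of the root, as a function of the root mid-edge `a` (no endpoint chosen): `compA Λ a`.
Blocks 4 and 5 of the cycle-4 argument (the rows clause resp. exhaustion pass to the root component) are proved in
parts 25 and 27 (`rowsComp_holds`, `exhaustsComp_holds`), where the assembly is completed. -/

/-- The root component: vertices of `Λ` linked inside `Λ` to an endpoint of `a` lying in `Λ`. [folklore] -/
noncomputable def compA (Λ : Finset HexVertex) (a : Sym2 HexVertex) : Finset HexVertex := by
  classical exact Λ.filter (fun v => ∃ w, w ∈ a ∧ w ∈ Λ ∧ Linked (↑Λ : Set HexVertex) w v)

/-- Membership in the root component. [folklore] -/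
theorem mem_compA {Λ : Finset HexVertex} {a : Sym2 HexVertex} {v : HexVertex} :
    v ∈ compA Λ a ↔ v ∈ Λ ∧ ∃ w, w ∈ a ∧ w ∈ Λ ∧ Linked (↑Λ : Set HexVertex) w v := by
  classical
  unfold compA; rw [Finset.mem_filter]

/-- For a boundary root `a = s(u,w)` (`u ∉ Λ`, `w ∈ Λ`) the root component is the component of `w`. [folklore] -/
theorem compA_eq_comp {Λ : Finset HexVertex} {u w : HexVertex} (hu : u ∉ Λ) (hw : w ∈ Λ) :
    compA Λ s(u, w) = comp Λ w := by
  ext v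
  rw [mem_compA, mem_comp]
  constructor
  · rintro ⟨hv, w', hw'a, hw'Λ, hl⟩
    rcases Sym2.mem_iff.1 hw'a with rfl | rfl
    · exact absurd hw'Λ hu
    · exact ⟨hv, hl⟩
  · rintro ⟨hv, hl⟩
    exact ⟨hv, w, Sym2.mem_mk_right _ _, hw, hl⟩

/-- The frame of the crux WITHOUT the `Preconnected` conjunct. [folklore] -/
def FrameNoConn (D : DobrushinDomain) (ρ : ℝ) (Λ : ℝ → Finset HexVertex) (m : ℝ → ℤ)
    (a b : ℝ → Sym2 HexVertex) : Prop :=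
  ∀ᶠ δ : ℝ in nhdsWithin 0 (Set.Ioi 0), hexDomainSimplyConnected (Λ δ) ∧
    a δ ∈ hexDomainBoundary (Λ δ) ∧ b δ ∈ hexDomainBoundary (Λ δ) ∧
    Nonempty (HexMidEdgeSAW (Λ δ) (a δ) (b δ)) ∧
    (∀ v ∈ Λ δ, (δ : ℂ) * hexCenter v ∈ D.carrier) ∧
    (∀ v : HexVertex, (δ : ℂ) * hexCenter v ∈ Metric.ball (D.pt 1) ρ → (v ∈ Λ δ ↔ m δ ≤ v.1 1))

/-- The crux at cut `c` with the `Preconnected` conjunct deleted (a strengthening). [folklore] -/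
def MassRatioAtWithoutPreconnected (c σ τ : ℝ) : Prop :=
  ∀ (D : DobrushinDomain) (ρ : ℝ) (Λ : ℝ → Finset HexVertex) (m : ℝ → ℤ) (a b : ℝ → Sym2 HexVertex),
    0 < ρ → Flat D ρ → FrameNoConn D ρ Λ m a b → Exhausts D Λ → ALim D a → BLim D b →
      Conclusion c σ τ D Λ a b

/-- No walk from `a` ends on a pair `z ≠ a` none of whose members lies in the domain: the observable
vanishes there. [folklore] -/
theorem observable_eq_zero_of_forall_not_mem {Λ : Finset HexVertex} {a z : Sym2 HexVertex}
    (hz : ∀ v ∈ z, v ∉ Λ) (haz : a ≠ z) (x σ : ℝ) :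
    hexParafermionicObservable Λ a x σ z = 0 := by
  have hempty : IsEmpty (HexMidEdgeSAW Λ a z) := by
    refine ⟨fun γ => ?_⟩
    by_cases hnil : γ.verts = []
    · exact haz (γ.eq_of_nil hnil)
    · exact hz _ (γ.getLast_mem _ (List.getLast?_eq_some_getLast hnil)) (γ.subset _ (List.getLast_mem hnil))
  unfold hexParafermionicObservable
  exact Fintype.sum_empty _

/-- The `K`-restricted `L¹` mass of `F_σ` is the same on `Λ` and on the component of the root. [folklore] -/
theorem finsum_comp_eq {Λ : Finset HexVertex} {u w : HexVertex} (hu : u ∉ Λ) (hw : w ∈ Λ)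
    (huw : hexGraph.Adj u w) (x σ : ℝ) (P : Sym2 HexVertex → Prop) :
    (∑ᶠ e ∈ {e : Sym2 HexVertex | e ∈ hexDomainMidEdges (comp Λ w) ∧ P e},
        ‖hexParafermionicObservable (comp Λ w) s(u, w) x σ e‖) =
      ∑ᶠ e ∈ {e : Sym2 HexVertex | e ∈ hexDomainMidEdges Λ ∧ P e},
        ‖hexParafermionicObservable Λ s(u, w) x σ e‖ := by
  set f : Sym2 HexVertex → ℝ := fun e => ‖hexParafermionicObservable Λ s(u, w) x σ e‖ with hf
  have step1 : (∑ᶠ e ∈ {e : Sym2 HexVertex | e ∈ hexDomainMidEdges (comp Λ w) ∧ P e},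
      ‖hexParafermionicObservable (comp Λ w) s(u, w) x σ e‖) =
      ∑ᶠ e ∈ {e : Sym2 HexVertex | e ∈ hexDomainMidEdges (comp Λ w) ∧ P e}, f e :=
    finsum_mem_congr rfl fun e _ => by simp only [hf, observable_comp_eq hu hw huw]
  have hset : {e : Sym2 HexVertex | e ∈ hexDomainMidEdges (comp Λ w) ∧ P e} ∩ Function.support f =
      {e : Sym2 HexVertex | e ∈ hexDomainMidEdges Λ ∧ P e} ∩ Function.support f := by
    ext e
    simp only [Set.mem_inter_iff, Set.mem_setOf_eq, Function.mem_support]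
    constructor
    · rintro ⟨⟨⟨he, v, hv, hvc⟩, hP⟩, hne⟩
      exact ⟨⟨⟨he, v, hv, comp_subset Λ w hvc⟩, hP⟩, hne⟩
    · rintro ⟨⟨⟨he, v, hv, hvΛ⟩, hP⟩, hne⟩
      refine ⟨⟨⟨he, ?_⟩, hP⟩, hne⟩
      by_contra hnone
      simp only [not_exists, not_and] at hnone
      apply hne
      have haz : s(u, w) ≠ e := by
        intro hae; subst hae
        exact hnone w (Sym2.mem_mk_right _ _) (self_mem_comp hw)
      show ‖hexParafermionicObservable Λ s(u, w) x σ e‖ = 0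
      rw [← observable_comp_eq hu hw huw, observable_eq_zero_of_forall_not_mem (fun v hv' hvc => hnone v hv' hvc) haz,
        norm_zero]
  rw [step1, ← finsum_mem_inter_support f {e : Sym2 HexVertex | e ∈ hexDomainMidEdges (comp Λ w) ∧ P e}, hset,
    finsum_mem_inter_support]

/-- The converse bookkeeping: the `Preconnected`-free statement is a strengthening. [folklore] -/
theorem massRatioAt_of_withoutPreconnected {c σ τ : ℝ} (h : MassRatioAtWithoutPreconnected c σ τ) :
    MassRatioAt c σ τ := fun D ρ Λ m a b hρ hflat hfr hex ha hb =>
  h D ρ Λ m a b hρ hflat (hfr.mono fun _ hδ =>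
    ⟨hδ.1, hδ.2.1, hδ.2.2.1, hδ.2.2.2.1, hδ.2.2.2.2.2.1, hδ.2.2.2.2.2.2⟩) hex ha hb

end Summit.CriticalPhenomena.SAWScalingLimit.Theorems.MassRatio.Negative
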